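import Literature.RingTheory.KTheory.MilnorPatchingTwist
import HarnessLib

/-!
# Milnor patching over a cartesian square of rings, II: Milnor's theorems 2.1–2.3

Topic `Literature/RingTheory/KTheory`; sequel of `MilnorPatchingTwist.lean`. J. Milnor,
*Introduction to Algebraic K-Theory* (1971), §2: for a Milnor square `A → A₁, A → A₂, A₁ ↠ A', A₂ → A'`
(`IsMilnorSquare`), a finitely generated projective `A₁`-module `P₁`, a finitely generated projective
`A₂`-module `P₂` and an `A'`-isomorphism `h : A' ⊗_{A₂} P₂ ≅ A' ⊗_{A₁} P₁` (a **patching datum**),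
Milnor's module `M(P₁, P₂, h) = {(p₁, p₂) | 1 ⊗ p₁ = h (1 ⊗ p₂)}` (`patch h`, an `A`-submodule of
`P₁ × P₂`) is

* finitely generated and projective — **Thm. 2.1** (`finite_patch`, `projective_patch`);
* such that the projections induce `A₁ ⊗_A M ≅ P₁`, `A₂ ⊗_A M ≅ P₂` — **Thm. 2.3**
  (`isBaseChange_patchFst`, `isBaseChange_patchSnd`, in Mathlib's `IsBaseChange` language);
* and every flat (e.g. projective) `A`-module `P` is `M(A₁ ⊗ P, A₂ ⊗ P, can)` — **Thm. 2.2**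
  (`equivPatchOfFlat`).

Proof as printed (Lemma 2.6 and "Proof of Theorem 2.1", pp. 21–22): split surjections
`A₁ʳ → P₁`, `A₂ˢ → P₂` give complements `P₁ ⊕ Q₁ ≅ A₁ʳ`, `P₂ ⊕ Q₂ ≅ A₂ˢ`; the complementary datum `k`
on `(Q₁ ⊕ A₁ˢ, A₂ʳ ⊕ Q₂)` exists (`A' ⊗ Q₁ ⊕ A'ˢ ≅ A' ⊗ Q₁ ⊕ P' ⊕ A' ⊗ Q₂ ≅ A' ⊗ Q₂ ⊕ A'ʳ`), and
`h ⊕ k` is a datum both of whose sides are extended from the free `A`-module `A^{r+s}`, i.e. a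
twisted datum `h_φ` (`milnor_of_common`: any datum whose two sides are `Aᵢ ⊗_A P` for one finitely
generated projective `P` is isomorphic to a twisted one, `patchCongr` + `patch_twistDatum`), to which
part I applies (`finite_and_projective_twistPatch`, `isBaseChange_twistFst/Snd`); `M(h)` is a direct
summand of `M(h ⊕ k) ≅ M(h) ⊕ M(k)` (`patchSum`) and base change of a direct sum of maps is
componentwise (`isBaseChange_prodMap_iff`).

Everything is proved; no named facts. Used for patching finite étale algebras
(`Literature/RingTheory/Etale/…`, conductor squares; Riemann's existence theorem SGA1 XII 5.1).

## References

* [Milnor1972] J. Milnor, *Introduction to Algebraic K-Theory*, Ann. of Math. Studies 72 (1971), §2: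
  basic construction `M(P₁, P₂, h)` (p. 20), Thm. 2.1, Thm. 2.2, Thm. 2.3 (p. 20), Lemma 2.6 and the
  proofs (pp. 21–22) — `p0018`–`p0020` of `lit read book:milnor1972-introduction-algebraic-k-theory`.

## Design

See part I: commutative rings, `h` oriented `A' ⊗_{A₂} P₂ → A' ⊗_{A₁} P₁` with `A₁ → A'` surjective
(Milnor's `j₂` surjective, relabelled). Mathlib has no patching of projective modules (searched:
`Milnor`, `patching`, `cartesian square`, `IsPullback` for `CommRingCat`/modules); the tree's
`Literature.AlgebraicTopology.KTheory.Clutching` is the topological `C(X)` instance with matrices.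
-/

noncomputable section

open TensorProduct

namespace Literature.RingTheory.KTheory

open IsMilnorSquare

variable (A A₁ A₂ A' : Type*) [CommRing A] [CommRing A₁] [CommRing A₂] [CommRing A']
  [Algebra A A₁] [Algebra A A₂] [Algebra A₁ A'] [Algebra A₂ A']

/-! ### Patching data `(P₁, P₂, h)` and Milnor's module `M(P₁, P₂, h)` -/

section General

variable [Algebra A A'] [IsScalarTower A A₁ A'] [IsScalarTower A A₂ A']
variable {P₁ : Type*} [AddCommGroup P₁] [Module A₁ P₁] [Module A P₁] [IsScalarTower A A₁ P₁]
variable {P₂ : Type*} [AddCommGroup P₂] [Module A₂ P₂] [Module A P₂] [IsScalarTower A A₂ P₂]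

omit [IsScalarTower A A₂ A'] [Algebra A₂ A'] [Algebra A A₂] in
/-- `1 ⊗ (a • p) = a • (1 ⊗ p)` in `A' ⊗[A₁] P₁` for `a : A`. [folklore] -/
theorem one_tmul_smul_base (a : A) (p : P₁) :
    ((1 : A') ⊗ₜ[A₁] (a • p) : A' ⊗[A₁] P₁) = a • ((1 : A') ⊗ₜ[A₁] p) := by
  rw [← smul_tmul, smul_tmul']

/-- **Milnor's patch** of a patching datum `h : A' ⊗_{A₂} P₂ ≅ A' ⊗_{A₁} P₁`: the `A`-module of
pairs `(p₁, p₂)` with `1 ⊗ p₁ = h (1 ⊗ p₂)`, `a · (p₁, p₂) = (a p₁, a p₂)`.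
[cite: Milnor1972, §2 Basic construction (p. 20)] -/
def patch (h : (A' ⊗[A₂] P₂) ≃ₗ[A'] (A' ⊗[A₁] P₁)) : Submodule A (P₁ × P₂) where
  carrier := {p | ((1 : A') ⊗ₜ[A₁] p.1 : A' ⊗[A₁] P₁) = h ((1 : A') ⊗ₜ[A₂] p.2)}
  add_mem' {p q} hp hq := by
    simp only [Set.mem_setOf_eq, Prod.fst_add, Prod.snd_add, tmul_add, map_add] at hp hq ⊢
    rw [hp, hq]
  zero_mem' := by simp
  smul_mem' a p hp := by
    simp only [Set.mem_setOf_eq, Prod.smul_fst, Prod.smul_snd] at hp ⊢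
    rw [one_tmul_smul_base, one_tmul_smul_base, hp]
    exact (h.toLinearMap.map_smul_of_tower a _).symm

variable {A A₁ A₂ A'}

/-- Membership in Milnor's module. [folklore] -/
theorem mem_patch {h : (A' ⊗[A₂] P₂) ≃ₗ[A'] (A' ⊗[A₁] P₁)} {p : P₁ × P₂} :
    p ∈ patch A A₁ A₂ A' h ↔ ((1 : A') ⊗ₜ[A₁] p.1 : A' ⊗[A₁] P₁) = h ((1 : A') ⊗ₜ[A₂] p.2) := Iff.rfl

variable (A A₁ A₂ A')

/-- First projection `M(P₁, P₂, h) → P₁`. [cite: Milnor1972, §2 Thm. 2.3 (p. 20)] -/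
def patchFst (h : (A' ⊗[A₂] P₂) ≃ₗ[A'] (A' ⊗[A₁] P₁)) : patch A A₁ A₂ A' h →ₗ[A] P₁ :=
  (LinearMap.fst A P₁ P₂).comp (patch A A₁ A₂ A' h).subtype

/-- Second projection `M(P₁, P₂, h) → P₂`. [cite: Milnor1972, §2 Thm. 2.3 (p. 20)] -/
def patchSnd (h : (A' ⊗[A₂] P₂) ≃ₗ[A'] (A' ⊗[A₁] P₁)) : patch A A₁ A₂ A' h →ₗ[A] P₂ :=
  (LinearMap.snd A P₁ P₂).comp (patch A A₁ A₂ A' h).subtype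

/-- Formula for `patchFst`. [folklore] -/
@[simp] theorem patchFst_apply (h : (A' ⊗[A₂] P₂) ≃ₗ[A'] (A' ⊗[A₁] P₁)) (p : patch A A₁ A₂ A' h) :
    patchFst A A₁ A₂ A' h p = (p : P₁ × P₂).1 := rfl
/-- Formula for `patchSnd`. [folklore] -/
@[simp] theorem patchSnd_apply (h : (A' ⊗[A₂] P₂) ≃ₗ[A'] (A' ⊗[A₁] P₁)) (p : patch A A₁ A₂ A' h) :
    patchSnd A A₁ A₂ A' h p = (p : P₁ × P₂).2 := rfl

/-! #### Transport along isomorphisms of data -/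

variable {P₁' : Type*} [AddCommGroup P₁'] [Module A₁ P₁'] [Module A P₁'] [IsScalarTower A A₁ P₁']
variable {P₂' : Type*} [AddCommGroup P₂'] [Module A₂ P₂'] [Module A P₂'] [IsScalarTower A A₂ P₂']

/-- **Isomorphic patching data have isomorphic patches**: `(e₁, e₂) : (P₁, P₂, h) ≅ (P₁', P₂', h')`
induces `M(h) ≅ M(h')` (used implicitly throughout Milnor's §2). [cite: Milnor1972, §2 (pp. 20–22)] -/
def patchCongr (h : (A' ⊗[A₂] P₂) ≃ₗ[A'] (A' ⊗[A₁] P₁)) (h' : (A' ⊗[A₂] P₂') ≃ₗ[A'] (A' ⊗[A₁] P₁'))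
    (e₁ : P₁ ≃ₗ[A₁] P₁') (e₂ : P₂ ≃ₗ[A₂] P₂')
    (hc : ∀ z, h' (e₂.baseChange A₂ A' _ _ z) = e₁.baseChange A₁ A' _ _ (h z)) :
    patch A A₁ A₂ A' h ≃ₗ[A] patch A A₁ A₂ A' h' :=
  LinearEquiv.ofSubmodules ((e₁.restrictScalars A).prodCongr (e₂.restrictScalars A)) _ _ (by
    ext p
    rw [Submodule.mem_map_equiv, mem_patch, mem_patch]
    change ((1 : A') ⊗ₜ[A₁] e₁.symm p.1 : A' ⊗[A₁] P₁) = h (1 ⊗ₜ[A₂] e₂.symm p.2) ↔ _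
    rw [← (e₁.baseChange A₁ A' P₁ P₁').injective.eq_iff, LinearEquiv.baseChange_tmul,
      LinearEquiv.apply_symm_apply, ← hc, LinearEquiv.baseChange_tmul, LinearEquiv.apply_symm_apply])

/-- Formula for `patchCongr`. [folklore] -/
@[simp] theorem coe_patchCongr (h : (A' ⊗[A₂] P₂) ≃ₗ[A'] (A' ⊗[A₁] P₁))
    (h' : (A' ⊗[A₂] P₂') ≃ₗ[A'] (A' ⊗[A₁] P₁')) (e₁ : P₁ ≃ₗ[A₁] P₁') (e₂ : P₂ ≃ₗ[A₂] P₂')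
    (hc : ∀ z, h' (e₂.baseChange A₂ A' _ _ z) = e₁.baseChange A₁ A' _ _ (h z)) (p : patch A A₁ A₂ A' h) :
    (patchCongr A A₁ A₂ A' h h' e₁ e₂ hc p : P₁' × P₂') = (e₁ (p : P₁ × P₂).1, e₂ (p : P₁ × P₂).2) := rfl

/-! #### Direct sums of data -/

variable {Q₁ : Type*} [AddCommGroup Q₁] [Module A₁ Q₁] [Module A Q₁] [IsScalarTower A A₁ Q₁]
variable {Q₂ : Type*} [AddCommGroup Q₂] [Module A₂ Q₂] [Module A Q₂] [IsScalarTower A A₂ Q₂]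

/-- The direct sum `h ⊕ k` of two patching data. [cite: Milnor1972, §2 proof of Lemma 2.5 (p. 21)] -/
def sumDatum (h : (A' ⊗[A₂] P₂) ≃ₗ[A'] (A' ⊗[A₁] P₁)) (k : (A' ⊗[A₂] Q₂) ≃ₗ[A'] (A' ⊗[A₁] Q₁)) :
    (A' ⊗[A₂] (P₂ × Q₂)) ≃ₗ[A'] (A' ⊗[A₁] (P₁ × Q₁)) :=
  (prodRight A₂ A' A' P₂ Q₂).trans ((h.prodCongr k).trans (prodRight A₁ A' A' P₁ Q₁).symm)

variable {A A₁ A₂ A'} in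
/-- Membership in `M(h ⊕ k)` is componentwise. [folklore] -/
theorem mem_patch_sumDatum_iff {h : (A' ⊗[A₂] P₂) ≃ₗ[A'] (A' ⊗[A₁] P₁)}
    {k : (A' ⊗[A₂] Q₂) ≃ₗ[A'] (A' ⊗[A₁] Q₁)} {p : (P₁ × Q₁) × (P₂ × Q₂)} :
    p ∈ patch A A₁ A₂ A' (sumDatum A₁ A₂ A' h k) ↔
      (p.1.1, p.2.1) ∈ patch A A₁ A₂ A' h ∧ (p.1.2, p.2.2) ∈ patch A A₁ A₂ A' k := by
  rw [mem_patch, mem_patch, mem_patch, sumDatum, LinearEquiv.trans_apply, LinearEquiv.trans_apply,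
    ← (prodRight A₁ A' A' P₁ Q₁).injective.eq_iff, LinearEquiv.apply_symm_apply]
  obtain ⟨⟨p₁, q₁⟩, ⟨p₂, q₂⟩⟩ := p
  simp

/-- **Patches are additive**: `M(P₁ ⊕ Q₁, P₂ ⊕ Q₂, h ⊕ k) ≅ M(P₁, P₂, h) ⊕ M(Q₁, Q₂, k)`.
[cite: Milnor1972, §2 proof of Lemma 2.5 and of Thm. 2.1 (pp. 21–22)] -/
def patchSum (h : (A' ⊗[A₂] P₂) ≃ₗ[A'] (A' ⊗[A₁] P₁)) (k : (A' ⊗[A₂] Q₂) ≃ₗ[A'] (A' ⊗[A₁] Q₁)) :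
    patch A A₁ A₂ A' (sumDatum A₁ A₂ A' h k) ≃ₗ[A] patch A A₁ A₂ A' h × patch A A₁ A₂ A' k where
  toFun p := (⟨(LinearEquiv.prodProdProdComm A P₁ Q₁ P₂ Q₂ p).1, (mem_patch_sumDatum_iff.mp p.2).1⟩,
    ⟨(LinearEquiv.prodProdProdComm A P₁ Q₁ P₂ Q₂ p).2, (mem_patch_sumDatum_iff.mp p.2).2⟩)
  invFun w := ⟨(LinearEquiv.prodProdProdComm A P₁ Q₁ P₂ Q₂).symm ((w.1 : P₁ × P₂), (w.2 : Q₁ × Q₂)),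
    mem_patch_sumDatum_iff.mpr ⟨w.1.2, w.2.2⟩⟩
  map_add' p q := by ext <;> rfl
  map_smul' a p := by ext <;> rfl
  left_inv p := by
    apply Subtype.ext
    obtain ⟨⟨⟨p₁, q₁⟩, ⟨p₂, q₂⟩⟩, -⟩ := p
    rfl
  right_inv w := by
    obtain ⟨⟨⟨p₁, p₂⟩, -⟩, ⟨⟨q₁, q₂⟩, -⟩⟩ := w
    rfl

/-- First component of `patchSum`. [folklore] -/
@[simp] theorem patchSum_apply_fst (h : (A' ⊗[A₂] P₂) ≃ₗ[A'] (A' ⊗[A₁] P₁))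
    (k : (A' ⊗[A₂] Q₂) ≃ₗ[A'] (A' ⊗[A₁] Q₁)) (p : patch A A₁ A₂ A' (sumDatum A₁ A₂ A' h k)) :
    ((patchSum A A₁ A₂ A' h k p).1 : P₁ × P₂) =
      ((p : (P₁ × Q₁) × (P₂ × Q₂)).1.1, (p : (P₁ × Q₁) × (P₂ × Q₂)).2.1) := rfl

/-- Second component of `patchSum`. [folklore] -/
@[simp] theorem patchSum_apply_snd (h : (A' ⊗[A₂] P₂) ≃ₗ[A'] (A' ⊗[A₁] P₁))
    (k : (A' ⊗[A₂] Q₂) ≃ₗ[A'] (A' ⊗[A₁] Q₁)) (p : patch A A₁ A₂ A' (sumDatum A₁ A₂ A' h k)) :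
    ((patchSum A A₁ A₂ A' h k p).2 : Q₁ × Q₂) =
      ((p : (P₁ × Q₁) × (P₂ × Q₂)).1.2, (p : (P₁ × Q₁) × (P₂ × Q₂)).2.2) := rfl

/-! #### Twisted data are patching data -/

variable (P : Type*) [AddCommGroup P] [Module A P]

/-- The patching datum `h_φ : A' ⊗_{A₂} (A₂ ⊗ P) ≅ A' ⊗ P →φ A' ⊗ P ≅ A' ⊗_{A₁} (A₁ ⊗ P)` attached to a
twist `φ` of `A' ⊗_A P` (for `φ = 1` Milnor's "canonical isomorphism" of the proof of Thm. 2.2).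
[cite: Milnor1972, §2 proof of Thm. 2.2 (p. 22)] -/
def twistDatum (φ : (A' ⊗[A] P) ≃ₗ[A'] (A' ⊗[A] P)) :
    (A' ⊗[A₂] (A₂ ⊗[A] P)) ≃ₗ[A'] (A' ⊗[A₁] (A₁ ⊗[A] P)) :=
  (AlgebraTensorModule.cancelBaseChange A A₂ A' A' P).trans
    (φ.trans (AlgebraTensorModule.cancelBaseChange A A₁ A' A' P).symm)

omit [IsScalarTower A A₂ A'] [Algebra A₂ A'] [Algebra A A₂] in
/-- `A' ⊗_{A₁} (A₁ ⊗_A P) ≅ A' ⊗_A P` sends `1 ⊗ x` to `ρ x`. [folklore] -/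
theorem cancelBaseChange_one_tmul (x : A₁ ⊗[A] P) :
    AlgebraTensorModule.cancelBaseChange A A₁ A' A' P ((1 : A') ⊗ₜ[A₁] x) = rho A A₁ A' P x := by
  induction x using TensorProduct.induction_on with
  | zero => simp
  | tmul a p => simp [Algebra.smul_def]
  | add x y hx hy => rw [tmul_add, map_add, map_add, hx, hy]

/-- The patch of the datum `h_φ` is the twisted patch of `φ` (part I). [folklore] -/
theorem patch_twistDatum (φ : (A' ⊗[A] P) ≃ₗ[A'] (A' ⊗[A] P)) :
    patch A A₁ A₂ A' (twistDatum A A₁ A₂ A' P φ) = twistPatch A A₁ A₂ A' P φ := by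
  ext z
  rw [mem_patch, mem_twistPatch, twistDatum, LinearEquiv.trans_apply, LinearEquiv.trans_apply,
    LinearEquiv.eq_symm_apply, cancelBaseChange_one_tmul, cancelBaseChange_one_tmul]

/-! #### A split surjection -/

/-- A split surjection `π : F → M` with section `ι` identifies `F` with `M × ker π`. [folklore] -/
def prodKerEquivOfSplit {R F M : Type*} [Ring R] [AddCommGroup F] [Module R F] [AddCommGroup M]
    [Module R M] (π : F →ₗ[R] M) (ι : M →ₗ[R] F) (hs : ∀ m, π (ι m) = m) :
    (M × LinearMap.ker π) ≃ₗ[R] F where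
  toFun x := ι x.1 + x.2
  invFun v := (π v, ⟨v - ι (π v), by rw [LinearMap.mem_ker, map_sub, hs, sub_self]⟩)
  map_add' x y := by simp only [Prod.fst_add, Prod.snd_add, map_add, Submodule.coe_add]; abel
  map_smul' r x := by simp [smul_add]
  left_inv x := by
    obtain ⟨m, ⟨q, hq⟩⟩ := x
    rw [LinearMap.mem_ker] at hq
    ext
    · simp [hs, hq]
    · simp [hs, hq]
  right_inv v := by simp


/-! ### Milnor's theorems -/

omit [IsScalarTower A A₁ A'] [Algebra A₁ A'] [Algebra A A₁] in
/-- `(e⁻¹)_{A'} ∘ e_{A'} = id` for the base change of an isomorphism `e`. [folklore] -/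
theorem baseChange_symm_baseChange {M N : Type*} [AddCommGroup M] [Module A₂ M] [AddCommGroup N]
    [Module A₂ N] (e : M ≃ₗ[A₂] N) (z : A' ⊗[A₂] M) :
    e.symm.baseChange A₂ A' _ _ (e.baseChange A₂ A' _ _ z) = z := by
  induction z using TensorProduct.induction_on with
  | zero => simp
  | tmul a m => simp
  | add x y hx hy => rw [map_add, map_add, hx, hy]

variable {A A₁ A₂ A'}

/-- **Milnor's Thms. 2.1–2.2 for data with a common free model.** If `(P₁, P₂, h)` and
`(X₁, X₂, k)` are patching data with `P₁ × X₁ ≅ A₁ ⊗ P` and `P₂ × X₂ ≅ A₂ ⊗ P` for one finitely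
generated projective `A`-module `P`, then `patch h` is finitely generated projective and its two
projections are base changes. (The datum `h ⊕ k` is isomorphic to a twisted datum `h_φ` on `P`.)
[cite: Milnor1972, §2 Thms. 2.1, 2.3, proof of Thm. 2.1 (pp. 20–22)] -/
theorem milnor_of_common (H : IsMilnorSquare A A₁ A₂ A')
    (h : (A' ⊗[A₂] P₂) ≃ₗ[A'] (A' ⊗[A₁] P₁))
    {X₁ : Type*} [AddCommGroup X₁] [Module A₁ X₁] [Module A X₁] [IsScalarTower A A₁ X₁]
    {X₂ : Type*} [AddCommGroup X₂] [Module A₂ X₂] [Module A X₂] [IsScalarTower A A₂ X₂]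
    (k : (A' ⊗[A₂] X₂) ≃ₗ[A'] (A' ⊗[A₁] X₁))
    (P : Type*) [AddCommGroup P] [Module A P] [Module.Finite A P] [Module.Projective A P]
    (e₁ : (P₁ × X₁) ≃ₗ[A₁] A₁ ⊗[A] P) (e₂ : (P₂ × X₂) ≃ₗ[A₂] A₂ ⊗[A] P) :
    (Module.Finite A (patch A A₁ A₂ A' h) ∧ Module.Projective A (patch A A₁ A₂ A' h)) ∧
      IsBaseChange A₁ (patchFst A A₁ A₂ A' h) ∧ IsBaseChange A₂ (patchSnd A A₁ A₂ A' h) := by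
  -- the twist `φ` making `(e₁, e₂)` an isomorphism of data `h ⊕ k ≅ h_φ`
  let φ : (A' ⊗[A] P) ≃ₗ[A'] (A' ⊗[A] P) :=
    (AlgebraTensorModule.cancelBaseChange A A₂ A' A' P).symm ≪≫ₗ e₂.symm.baseChange A₂ A' _ _ ≪≫ₗ
      sumDatum A₁ A₂ A' h k ≪≫ₗ e₁.baseChange A₁ A' _ _ ≪≫ₗ AlgebraTensorModule.cancelBaseChange A A₁ A' A' P
  have hc : ∀ z, twistDatum A A₁ A₂ A' P φ (e₂.baseChange A₂ A' _ _ z) =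
      e₁.baseChange A₁ A' _ _ (sumDatum A₁ A₂ A' h k z) := by
    intro z
    simp only [twistDatum, φ, LinearEquiv.trans_apply, LinearEquiv.symm_apply_apply,
      baseChange_symm_baseChange]
  let E : (patch A A₁ A₂ A' h × patch A A₁ A₂ A' k) ≃ₗ[A] twistPatch A A₁ A₂ A' P φ :=
    (patchSum A A₁ A₂ A' h k).symm ≪≫ₗ patchCongr A A₁ A₂ A' _ _ e₁ e₂ hc ≪≫ₗ
      LinearEquiv.ofEq _ _ (patch_twistDatum A A₁ A₂ A' P φ)
  have hE₁ : ∀ w, twistFst A A₁ A₂ A' P φ (E w) =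
      e₁ (((patchFst A A₁ A₂ A' h).prodMap (patchFst A A₁ A₂ A' k)) w) := fun w ↦ rfl
  have hE₂ : ∀ w, twistSnd A A₁ A₂ A' P φ (E w) =
      e₂ (((patchSnd A A₁ A₂ A' h).prodMap (patchSnd A A₁ A₂ A' k)) w) := fun w ↦ rfl
  obtain ⟨hfin, hproj⟩ := finite_and_projective_twistPatch A A₁ A₂ A' P H φ
  haveI : Module.Finite A (patch A A₁ A₂ A' h × patch A A₁ A₂ A' k) := Module.Finite.equiv E.symm
  haveI : Module.Projective A (patch A A₁ A₂ A' h × patch A A₁ A₂ A' k) := Module.Projective.of_equiv E.symm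
  refine ⟨⟨Module.Finite.of_surjective (LinearMap.fst A (patch A A₁ A₂ A' h) (patch A A₁ A₂ A' k))
      Prod.fst_surjective,
    Module.Projective.of_split (LinearMap.inl A (patch A A₁ A₂ A' h) (patch A A₁ A₂ A' k))
      (LinearMap.fst A (patch A A₁ A₂ A' h) (patch A A₁ A₂ A' k)) (LinearMap.fst_comp_inl _ _ _)⟩, ?_, ?_⟩
  · have hb : IsBaseChange A₁ ((patchFst A A₁ A₂ A' h).prodMap (patchFst A A₁ A₂ A' k)) :=
      isBaseChange_of_equiv_comm (isBaseChange_twistFst A A₁ A₂ A' P H φ) E.symm e₁.symm (fun v ↦ by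
        obtain ⟨w, rfl⟩ := E.surjective v
        rw [LinearEquiv.symm_apply_apply, LinearEquiv.eq_symm_apply, hE₁])
    exact ((isBaseChange_prodMap_iff _ _).mp hb).1
  · have hb : IsBaseChange A₂ ((patchSnd A A₁ A₂ A' h).prodMap (patchSnd A A₁ A₂ A' k)) :=
      isBaseChange_of_equiv_comm (isBaseChange_twistSnd A A₁ A₂ A' P H φ) E.symm e₂.symm (fun v ↦ by
        obtain ⟨w, rfl⟩ := E.surjective v
        rw [LinearEquiv.symm_apply_apply, LinearEquiv.eq_symm_apply, hE₂])
    exact ((isBaseChange_prodMap_iff _ _).mp hb).1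


/-- **Milnor patching** (Milnor, *Introduction to algebraic K-theory*, §2, Thms. 2.1 and 2.2).
Let `A → A₁, A → A₂, A₁ → A', A₂ → A'` be a Milnor square (`A = A₁ ×_{A'} A₂`, `A₁ → A'`
surjective), `P₁` a finitely generated projective `A₁`-module, `P₂` a finitely generated projective
`A₂`-module and `h : A' ⊗_{A₂} P₂ ≅ A' ⊗_{A₁} P₁` an `A'`-isomorphism. Then the `A`-module
`M = {(p₁, p₂) | 1 ⊗ p₁ = h (1 ⊗ p₂)}` is finitely generated projective (Thm. 2.1), and the
projections induce isomorphisms `A₁ ⊗_A M ≅ P₁`, `A₂ ⊗_A M ≅ P₂` (Thm. 2.3). Proof as printed: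
choosing complements `P₁ ⊕ Q₁ ≅ A₁ʳ`, `P₂ ⊕ Q₂ ≅ A₂ˢ`, the datum `h` plus the complementary datum
on `(Q₁ ⊕ A₁ˢ, A₂ʳ ⊕ Q₂)` has both sides free of rank `r + s`, i.e. is a twisted datum `h_φ` on
`A^{r+s}` (`milnor_of_common`, Lemma 2.6), and twisted data are handled by Whitehead's lemma
(`finite_and_projective_twistPatch`, Lemma 2.5). [cite: Milnor1972, §2 Thm. 2.1, Thm. 2.3, Lemma 2.6 (pp. 20–22)] -/
theorem milnor_patching (H : IsMilnorSquare A A₁ A₂ A') [Module.Finite A₁ P₁] [Module.Projective A₁ P₁]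
    [Module.Finite A₂ P₂] [Module.Projective A₂ P₂] (h : (A' ⊗[A₂] P₂) ≃ₗ[A'] (A' ⊗[A₁] P₁)) :
    (Module.Finite A (patch A A₁ A₂ A' h) ∧ Module.Projective A (patch A A₁ A₂ A' h)) ∧
      IsBaseChange A₁ (patchFst A A₁ A₂ A' h) ∧ IsBaseChange A₂ (patchSnd A A₁ A₂ A' h) := by
  classical
  -- complements `P₁ × Q₁ ≅ A₁ʳ`, `P₂ × Q₂ ≅ A₂ˢ`
  obtain ⟨r, π₁, hπ₁⟩ := Module.Finite.exists_fin' A₁ P₁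
  obtain ⟨ι₁, hι₁⟩ := Module.projective_lifting_property π₁ LinearMap.id hπ₁
  obtain ⟨s, π₂, hπ₂⟩ := Module.Finite.exists_fin' A₂ P₂
  obtain ⟨ι₂, hι₂⟩ := Module.projective_lifting_property π₂ LinearMap.id hπ₂
  let σ₁ : (P₁ × LinearMap.ker π₁) ≃ₗ[A₁] (Fin r → A₁) :=
    prodKerEquivOfSplit π₁ ι₁ (fun m ↦ LinearMap.congr_fun hι₁ m)
  let σ₂ : (P₂ × LinearMap.ker π₂) ≃ₗ[A₂] (Fin s → A₂) :=
    prodKerEquivOfSplit π₂ ι₂ (fun m ↦ LinearMap.congr_fun hι₂ m)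
  -- the free models `F = Aʳ`, `G = Aˢ`
  let eF : A₁ ⊗[A] (Fin r → A) ≃ₗ[A₁] (Fin r → A₁) := TensorProduct.piScalarRight A A₁ A₁ (Fin r)
  let eG : A₂ ⊗[A] (Fin s → A) ≃ₗ[A₂] (Fin s → A₂) := TensorProduct.piScalarRight A A₂ A₂ (Fin s)
  -- `A' ⊗ F ≅ P₁' × Q₁'`, `A' ⊗ G ≅ P₂' × Q₂'` (primes: base change to `A'`)
  let cF : (A' ⊗[A] (Fin r → A)) ≃ₗ[A'] (A' ⊗[A₁] P₁) × (A' ⊗[A₁] LinearMap.ker π₁) :=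
    (AlgebraTensorModule.cancelBaseChange A A₁ A' A' (Fin r → A)).symm ≪≫ₗ eF.baseChange A₁ A' _ _ ≪≫ₗ
      σ₁.symm.baseChange A₁ A' _ _ ≪≫ₗ prodRight A₁ A' A' P₁ (LinearMap.ker π₁)
  let cG : (A' ⊗[A] (Fin s → A)) ≃ₗ[A'] (A' ⊗[A₂] P₂) × (A' ⊗[A₂] LinearMap.ker π₂) :=
    (AlgebraTensorModule.cancelBaseChange A A₂ A' A' (Fin s → A)).symm ≪≫ₗ eG.baseChange A₂ A' _ _ ≪≫ₗ
      σ₂.symm.baseChange A₂ A' _ _ ≪≫ₗ prodRight A₂ A' A' P₂ (LinearMap.ker π₂)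
  -- the complementary datum `k` on `(Q₁ × A₁ ⊗ G, A₂ ⊗ F × Q₂)`
  let k : (A' ⊗[A₂] ((A₂ ⊗[A] (Fin r → A)) × LinearMap.ker π₂)) ≃ₗ[A']
      (A' ⊗[A₁] (LinearMap.ker π₁ × (A₁ ⊗[A] (Fin s → A)))) :=
    (prodRight A₂ A' A' (A₂ ⊗[A] (Fin r → A)) (LinearMap.ker π₂) ≪≫ₗ
      (AlgebraTensorModule.cancelBaseChange A A₂ A' A' (Fin r → A)).prodCongr (LinearEquiv.refl A' _) ≪≫ₗ
      cF.prodCongr (LinearEquiv.refl A' _) ≪≫ₗ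
      (LinearEquiv.prodComm A' _ _).prodCongr (LinearEquiv.refl A' _) ≪≫ₗ
      LinearEquiv.prodAssoc A' _ _ _) ≪≫ₗ
    (prodRight A₁ A' A' (LinearMap.ker π₁) (A₁ ⊗[A] (Fin s → A)) ≪≫ₗ
      (LinearEquiv.refl A' _).prodCongr (AlgebraTensorModule.cancelBaseChange A A₁ A' A' (Fin s → A)) ≪≫ₗ
      (LinearEquiv.refl A' _).prodCongr cG ≪≫ₗ
      (LinearEquiv.refl A' _).prodCongr (h.prodCongr (LinearEquiv.refl A' _))).symm
  -- both sides of `h ⊕ k` are extended from `F × G`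
  let e₁ : (P₁ × (LinearMap.ker π₁ × (A₁ ⊗[A] (Fin s → A)))) ≃ₗ[A₁]
      A₁ ⊗[A] ((Fin r → A) × (Fin s → A)) :=
    (LinearEquiv.prodAssoc A₁ P₁ (LinearMap.ker π₁) _).symm ≪≫ₗ σ₁.prodCongr (LinearEquiv.refl A₁ _) ≪≫ₗ
      eF.symm.prodCongr (LinearEquiv.refl A₁ _) ≪≫ₗ (prodRight A A₁ A₁ (Fin r → A) (Fin s → A)).symm
  let e₂ : (P₂ × ((A₂ ⊗[A] (Fin r → A)) × LinearMap.ker π₂)) ≃ₗ[A₂]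
      A₂ ⊗[A] ((Fin r → A) × (Fin s → A)) :=
    (LinearEquiv.prodAssoc A₂ P₂ _ (LinearMap.ker π₂)).symm ≪≫ₗ
      (LinearEquiv.prodComm A₂ P₂ _).prodCongr (LinearEquiv.refl A₂ _) ≪≫ₗ
      LinearEquiv.prodAssoc A₂ _ P₂ (LinearMap.ker π₂) ≪≫ₗ (LinearEquiv.refl A₂ _).prodCongr σ₂ ≪≫ₗ
      (LinearEquiv.refl A₂ _).prodCongr eG.symm ≪≫ₗ (prodRight A A₂ A₂ (Fin r → A) (Fin s → A)).symm
  exact milnor_of_common H h k ((Fin r → A) × (Fin s → A)) e₁ e₂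

/-- **Milnor's Thm. 2.1**: the patch of finitely generated projective modules over a Milnor square is
finitely generated. [cite: Milnor1972, §2 Thm. 2.1 (p. 20)] -/
theorem finite_patch (H : IsMilnorSquare A A₁ A₂ A') [Module.Finite A₁ P₁] [Module.Projective A₁ P₁]
    [Module.Finite A₂ P₂] [Module.Projective A₂ P₂] (h : (A' ⊗[A₂] P₂) ≃ₗ[A'] (A' ⊗[A₁] P₁)) :
    Module.Finite A (patch A A₁ A₂ A' h) :=
  (milnor_patching H h).1.1

/-- **Milnor's Thm. 2.1**: the patch of finitely generated projective modules over a Milnor square is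
projective. [cite: Milnor1972, §2 Thm. 2.1 (p. 20)] -/
theorem projective_patch (H : IsMilnorSquare A A₁ A₂ A') [Module.Finite A₁ P₁] [Module.Projective A₁ P₁]
    [Module.Finite A₂ P₂] [Module.Projective A₂ P₂] (h : (A' ⊗[A₂] P₂) ≃ₗ[A'] (A' ⊗[A₁] P₁)) :
    Module.Projective A (patch A A₁ A₂ A' h) :=
  (milnor_patching H h).1.2

/-- **Milnor's Thm. 2.3**, first factor: `A₁ ⊗_A M(P₁, P₂, h) ≅ P₁` via the first projection.
[cite: Milnor1972, §2 Thm. 2.3 (p. 20)] -/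
theorem isBaseChange_patchFst (H : IsMilnorSquare A A₁ A₂ A') [Module.Finite A₁ P₁]
    [Module.Projective A₁ P₁] [Module.Finite A₂ P₂] [Module.Projective A₂ P₂]
    (h : (A' ⊗[A₂] P₂) ≃ₗ[A'] (A' ⊗[A₁] P₁)) : IsBaseChange A₁ (patchFst A A₁ A₂ A' h) :=
  (milnor_patching H h).2.1

/-- **Milnor's Thm. 2.3**, second factor: `A₂ ⊗_A M(P₁, P₂, h) ≅ P₂` via the second projection.
[cite: Milnor1972, §2 Thm. 2.3 (p. 20)] -/
theorem isBaseChange_patchSnd (H : IsMilnorSquare A A₁ A₂ A') [Module.Finite A₁ P₁]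
    [Module.Projective A₁ P₁] [Module.Finite A₂ P₂] [Module.Projective A₂ P₂]
    (h : (A' ⊗[A₂] P₂) ≃ₗ[A'] (A' ⊗[A₁] P₁)) : IsBaseChange A₂ (patchSnd A A₁ A₂ A' h) :=
  (milnor_patching H h).2.2

/-- **Milnor's Thm. 2.2**: a projective (indeed any flat) `A`-module `P` is recovered as
`M(A₁ ⊗ P, A₂ ⊗ P, can)`. [cite: Milnor1972, §2 Thm. 2.2 and its proof (pp. 20, 22)] -/
def equivPatchOfFlat (H : IsMilnorSquare A A₁ A₂ A') (P : Type*) [AddCommGroup P] [Module A P]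
    [Module.Flat A P] :
    P ≃ₗ[A] patch A A₁ A₂ A' (twistDatum A A₁ A₂ A' P (LinearEquiv.refl A' _)) :=
  (twistEquivOfFlat P H).trans (LinearEquiv.ofEq _ _ (patch_twistDatum A A₁ A₂ A' P _).symm)

end General

end Literature.RingTheory.KTheory

end
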